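import Literature.Probability.Percolation.SlabGluingFact2Reduction
import HarnessLib

/-!
# DST 2016, §2.3, Fact 2 — the connector surgery (a branch attached to `γ_min` itself)

Topic: `Literature/Probability/Percolation`. Towards the verbatim discharge of
`DuminilCopinSidoraviciusTassion2016_fact2` (`SlabGluing.lean`; reduction to located surgeries in
`SlabGluingFact2Reduction.lean`). The tree's local surgery (`GlueGeom.Surgery`,
`SlabGluingFact2Core.lean`) clears a box and REROUTES `γ_min(ω)` through it; it needs `γ_min(ω)` to
leave the box again and is therefore unavailable near the end of `γ_min(ω)`. This file provides a
second, simpler mechanism for such points — the variant of DST's construction in which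
`γ_min(ω)` is KEPT and only a branch is attached to it (the situation of the exchange lemma
`minPath_eq_of_surgery` of `SlabGluingSurgery.lean`):

* `GlueGeom.Connector G k ω` — the data: an attachment vertex `g` of `γ = γ_min(ω)`, a lattice
  path `g, I₁, …, I_m, x₁` (`m ≥ 1`) whose interior `I` is off `γ`, off `S̄_{3n}` and off the
  `S'`-side path `σ`, an `ω`-open path `σ` from `x₁` to `S̄'_n` inside `B̄'_n`, and DST's order
  condition "`(z,v) ≺ (z,w)`": the successor of `g` on `γ` (if any) has a smaller key than `I₁`
  (vacuous when `g` is the last vertex of `γ`);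
* `Connector.newConfig` — the new configuration: all edges at interior vertices are closed, the
  edges of the path `g, I, x₁` are opened. PROVED: it is a lattice configuration inside the window
  (`newConfig_lattice`, `newConfig_subset_window`), it agrees with `ω` off the pairs incident to
  `I` (`mem_newConfig_iff_of_not_incid`), `γ` and `σ` stay open;
* `Connector.γmin_newConfig` — PROVED: **`γ_min(ω') = γ_min(ω)`** (by `minPath_eq_of_surgery`:
  the interior is isolated, `x₁` is not `ω`-joined to `S̄_{3n}` since `ω ∉ C`, the order condition);
* `Connector.newConfig_mem_evC`, `Connector.att_eq` — PROVED: **`ω' ∈ C`** and **`Att(ω') = {g}`**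
  (`g` is attached through `I`, `x₁`, `σ`; any other vertex of `γ` joined to `S̄'_n` off `γ` in `ω'`
  would be so in `ω`, by the propagation lemma `not_mem_structure_of_openConnIn` of
  `SlabGluingRecovery.lean`, forcing `C(ω)`);
* `Connector.surgOut` — PROVED: if `g`, `I`, `x₁` lie over `z + B_r` and `g` over `z + B_3`, the
  new configuration is a located surgery output `GlueGeom.SurgOut G k r ω z` in the sense of
  `SlabGluingFact2Reduction.lean`.

Intended use (unit notes): `g` = the last vertex `e` of `γ_min(ω)` (order condition vacuous), the
path running inside `Z̄_n` (which `γ_min` meets only at `e`) or through the column of a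
(P2)-witness lattice-adjacent to the column of `e` (a column off those of `γ_min`), for the points
of `U(ω)` near the end of `γ_min(ω)` that the box surgeries cannot treat.

## Sources

* H. Duminil-Copin, V. Sidoravicius, V. Tassion, *Absence of infinite cluster for critical
  Bernoulli percolation on slabs*, CPAM 69 (2016), 1397–1411, arXiv:1401.7130: §2.3, proof of
  Fact 2 (pp. 6–7: the order condition `(z,v) ≺ (z,w)`, "the minimality of `γ_min(ω)` … implies",
  "`z` is the only site on `γ_min(ω^{(z)})` to be connected to `\overline{S'_n}` without using any
  edge in `γ_min(ω^{(z)})`").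
* C. M. Newman, V. Tassion, W. Wu, *Critical percolation and the minimal spanning tree in slabs*,
  CPAM 70 (2017), §3.2, proof of Thm. 3.9 [NewmanTassionWu2017].
-/

noncomputable section

namespace Literature.Probability.Percolation

open LatticeModels SimpleGraph

/-! ## Pairs incident to a list of vertices -/

section Incid

variable (k : ℕ)

/-- The pairs having an endpoint in the list `I` (the edges reset at the interior of the attached
path). [cite: DuminilCopinSidoraviciusTassion2016, §2.3, proof of Fact 2 ("Close all edges …")] -/
def incid (I : List (slab 3 k)) : Set (Sym2 (slab 3 k)) := {e | ∃ x, x ∈ e ∧ x ∈ I}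

variable {k}

/-- Membership of a pair in `incid I`. [folklore] -/
@[simp] theorem mk_mem_incid_iff {I : List (slab 3 k)} {a b : slab 3 k} :
    s(a, b) ∈ incid k I ↔ a ∈ I ∨ b ∈ I := by
  constructor
  · rintro ⟨x, hx, hxI⟩
    rcases Sym2.mem_iff.1 hx with rfl | rfl
    · exact Or.inl hxI
    · exact Or.inr hxI
  · rintro (h | h)
    · exact ⟨a, Sym2.mem_mk_left _ _, h⟩
    · exact ⟨b, Sym2.mem_mk_right _ _, h⟩

/-- Pairs incident to vertices over `T` touch `T`. [folklore] -/
theorem incid_subset_touch {I : List (slab 3 k)} {T : Set (ℤ × ℤ)} (h : ∀ x ∈ I, planar k x ∈ T) :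
    incid k I ⊆ touch k T := by
  rintro e ⟨x, hx, hxI⟩
  exact ⟨x, hx, h x hxI⟩

end Incid

/-! ## The connector data and the new configuration -/

section ConnectorData

variable (k : ℕ)

/-- **The data of a connector surgery** (DST 2016, §2.3, proof of Fact 2, in the variant keeping
`γ_min(ω)`): an attachment vertex `g ∈ γ_min(ω)`; a lattice path `g, I₁, …, I_m, x₁` (`m ≥ 1`,
self-avoiding) whose interior `I` lies in `\overline{B_{3n} ∪ B'_n}`, off `γ_min(ω)`, off `σ` and off
`S̄_{3n}`; DST's order condition (the successor of `g` on `γ_min(ω)` has a smaller key than `I₁`);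
and the `S'`-side path `σ` from `x₁` to `S̄'_n`, `ω`-open, inside `B̄'_n`.
[cite: DuminilCopinSidoraviciusTassion2016, §2.3, proof of Fact 2 (pp. 6–7)] -/
structure GlueGeom.Connector (G : GlueGeom) (ω : BondConfig (slab 3 k)) where
  /-- the attachment vertex on `γ_min(ω)` -/
  g : slab 3 k
  /-- the interior of the attached path (non-empty) -/
  I : List (slab 3 k)
  /-- the far end of the attached path, first vertex of `σ` -/
  x₁ : slab 3 k
  /-- the `S'`-side path from `x₁` -/
  σ : List (slab 3 k)
  hg : g ∈ G.γmin k ω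
  hI : I ≠ []
  hchain : (g :: (I ++ [x₁])).IsChain (fun a b => (slabGraph 3 k).Adj a b)
  hnodup : (g :: (I ++ [x₁])).Nodup
  hIreg : ∀ x ∈ I, x ∈ slabLift k (G.big ∪ G.small)
  hIγ : ∀ x ∈ I, x ∉ G.γmin k ω
  hIσ : ∀ x ∈ I, x ∉ σ
  hIsrc : ∀ x ∈ I, x ∉ slabLift k G.src
  hfwd : ∀ (l₁ l₂ : List (slab 3 k)) (y : slab 3 k), G.γmin k ω = l₁ ++ g :: y :: l₂ →
    vKey k y < vKey k (I.head hI)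
  hσ : σ.head? = some x₁
  hσchain : σ.IsChain (fun a b => s(a, b) ∈ ω ∧ a ≠ b)
  hσsmall : ∀ x ∈ σ, planar k x ∈ G.small
  hσsrc' : ∀ h : σ ≠ [], σ.getLast h ∈ slabLift k G.src'

namespace GlueGeom.Connector

variable {k} {G : GlueGeom} {ω : BondConfig (slab 3 k)} (cn : G.Connector k ω)

/-- The attached path `g, I, x₁`. [cite: DuminilCopinSidoraviciusTassion2016, §2.3, proof of Fact 2] -/
def path : List (slab 3 k) := cn.g :: (cn.I ++ [cn.x₁])

/-- The opened edges: those of the attached path. [cite: DuminilCopinSidoraviciusTassion2016, §2.3, proof of Fact 2 ("Open the edges …")] -/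
def newEdges : Set (Sym2 (slab 3 k)) := edgesOf cn.path

/-- **The new configuration**: close every edge at an interior vertex, open the attached path.
[cite: DuminilCopinSidoraviciusTassion2016, §2.3, proof of Fact 2 (pp. 6–7)] -/
def newConfig : BondConfig (slab 3 k) := (ω \ incid k cn.I) ∪ cn.newEdges

/-! ### Elementary consequences of the data -/

/-- `σ` is non-empty. [folklore] -/
theorem σ_ne_nil : cn.σ ≠ [] := by
  intro h; have := cn.hσ; rw [h] at this; simp at this

/-- `σ` starts at `x₁`. [folklore] -/
theorem σ_eq_cons : cn.σ = cn.x₁ :: cn.σ.tail := by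
  obtain ⟨a, t, h⟩ := List.exists_cons_of_ne_nil cn.σ_ne_nil
  have := cn.hσ
  rw [h] at this ⊢
  simp only [List.head?_cons, Option.some.injEq] at this
  rw [this]; rfl

/-- `x₁ ∈ σ`. [folklore] -/
theorem x₁_mem_σ : cn.x₁ ∈ cn.σ := by rw [cn.σ_eq_cons]; exact List.mem_cons_self

/-- Membership in the attached path. [folklore] -/
theorem mem_path_iff {x : slab 3 k} : x ∈ cn.path ↔ x = cn.g ∨ x ∈ cn.I ∨ x = cn.x₁ := by
  simp [path]

/-- `g ∉ I`. [folklore] -/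
theorem g_not_mem_I : cn.g ∉ cn.I := by
  intro h
  have := cn.hnodup
  rw [List.nodup_cons] at this
  exact this.1 (List.mem_append_left _ h)

/-- `g ≠ x₁`. [folklore] -/
theorem g_ne_x₁ : cn.g ≠ cn.x₁ := by
  intro h
  have := cn.hnodup
  rw [List.nodup_cons] at this
  exact this.1 (by rw [h]; simp)

/-- `x₁ ∉ I`. [folklore] -/
theorem x₁_not_mem_I : cn.x₁ ∉ cn.I := by
  intro h
  have := cn.hnodup
  rw [List.nodup_cons] at this
  exact (List.nodup_append.1 this.2).2.2 _ h _ (by simp) rfl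

/-- Every vertex of `σ` is `ω`-joined inside `B̄'_n` to the end of `σ` (in `S̄'_n`). [folklore] -/
theorem σ_joined {x : slab 3 k} (hx : x ∈ cn.σ) :
    ω ∈ openConnIn (slabLift k G.small) x (cn.σ.getLast cn.σ_ne_nil) := by
  have hch := cn.hσchain
  have hσ := cn.σ_eq_cons
  rw [hσ] at hch
  have hsub : ∀ y ∈ cn.x₁ :: cn.σ.tail, y ∈ slabLift k G.small :=
    fun y hy => cn.hσsmall y (by rw [hσ]; exact hy)
  have h1 : ω ∈ openConnIn (slabLift k G.small) cn.x₁ x :=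
    openConnIn_head_of_mem _ _ hch hsub x (by rw [hσ] at hx; exact hx)
  have h2 : ω ∈ openConnIn (slabLift k G.small) cn.x₁ ((cn.x₁ :: cn.σ.tail).getLast (by simp)) :=
    openConnIn_of_isChain _ _ hch hsub
  have h3 : (cn.x₁ :: cn.σ.tail).getLast (by simp) = cn.σ.getLast cn.σ_ne_nil :=
    List.getLast_congr _ _ hσ.symm
  rw [h3] at h2
  exact SlabCriticality.openConnIn_trans (openConnIn_reverse h1) h2

/-- On `A ∩ Cᶜ`, no vertex of `σ` lies on `γ_min(ω)`. [folklore] -/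
theorem σ_not_mem_γ (hA : ω ∈ G.evA k) (hC : ω ∉ G.evC k) {x : slab 3 k} (hx : x ∈ cn.σ) :
    x ∉ G.γmin k ω := fun hxγ =>
  hC (G.evC_of_mem_γmin_of_joined k hA hxγ (cn.hσsrc' cn.σ_ne_nil) (cn.σ_joined hx))

/-- On `A ∩ Cᶜ`, no vertex of `σ` is `ω`-joined inside `B̄_{3n} ∪ B̄'_n` to a vertex of `S̄_{3n}`.
[folklore] -/
theorem σ_not_joined (hC : ω ∉ G.evC k) {x : slab 3 k} (hx : x ∈ cn.σ) {a : slab 3 k}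
    (ha : a ∈ slabLift k G.src) (h : ω ∈ openConnIn (slabLift k (G.big ∪ G.small)) a x) : False :=
  hC ⟨a, ha, _, cn.hσsrc' cn.σ_ne_nil, SlabCriticality.openConnIn_trans h
    (openConnIn_mono (slabLift_mono k Set.subset_union_right) _ _ (cn.σ_joined hx))⟩

/-- The vertices of the attached path lie in the window. [folklore] -/
theorem path_subset_region (hA : ω ∈ G.evA k) {x : slab 3 k} (hx : x ∈ cn.path) :
    x ∈ slabLift k (G.big ∪ G.small) := by
  rcases cn.mem_path_iff.1 hx with rfl | h | rfl
  · exact slabLift_mono k Set.subset_union_left ((G.γmin_spec k hA).1.subset _ cn.hg)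
  · exact cn.hIreg x h
  · exact slabLift_mono k Set.subset_union_right (cn.hσsmall _ cn.x₁_mem_σ)

/-! ### The new edges -/

/-- Both endpoints of a new edge lie on the attached path. [folklore] -/
theorem newEdges_path {a b : slab 3 k} (h : s(a, b) ∈ cn.newEdges) : a ∈ cn.path ∧ b ∈ cn.path :=
  mem_of_mem_edgesOf h

/-- Consecutive vertices of the attached path: the first is `g` or interior, the second is
interior or `x₁`, and `g` is followed by `I₁`. [folklore] -/
theorem consec_cases {a b : slab 3 k} {l₁ l₂ : List (slab 3 k)} (h : cn.path = l₁ ++ a :: b :: l₂) :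
    (a = cn.g ∧ b = cn.I.head cn.hI) ∨ a ∈ cn.I := by
  cases l₁ with
  | nil =>
    simp only [path, List.nil_append, List.cons.injEq] at h
    obtain ⟨rfl, h⟩ := h
    left
    refine ⟨rfl, ?_⟩
    obtain ⟨i, is, hi⟩ := List.exists_cons_of_ne_nil cn.hI
    rw [eq_comm, List.head_eq_iff_head?_eq_some, hi]
    rw [hi] at h
    simp only [List.cons_append, List.cons.injEq] at h
    simp [h.1]
  | cons y l₁ =>
    simp only [path, List.cons_append, List.cons.injEq] at h
    obtain ⟨-, h⟩ := h
    right
    -- `I ++ [x₁] = l₁ ++ a :: b :: l₂`: dropping the last element keeps `a`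
    have := congrArg List.dropLast h
    rw [List.dropLast_concat, List.dropLast_append_of_ne_nil (List.cons_ne_nil a (b :: l₂))] at this
    rw [this]; simp

/-- The second of two consecutive vertices of the attached path is interior or `x₁`. [folklore] -/
theorem consec_snd_mem {a b : slab 3 k} {l₁ l₂ : List (slab 3 k)} (h : cn.path = l₁ ++ a :: b :: l₂) :
    b ∈ cn.I ∨ b = cn.x₁ := by
  have hb : b ∈ cn.I ++ [cn.x₁] := by
    cases l₁ with
    | nil =>
      simp only [path, List.nil_append, List.cons.injEq] at h
      rw [h.2]; simp
    | cons y l₁ =>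
      simp only [path, List.cons_append, List.cons.injEq] at h
      rw [h.2]; simp
  simpa using hb

/-- Every new edge has an interior endpoint. [folklore] -/
theorem newEdges_incid : cn.newEdges ⊆ incid k cn.I := by
  rintro e ⟨a, b, l₁, l₂, h, rfl⟩
  rw [mk_mem_incid_iff]
  rcases cn.consec_cases h with ⟨-, rfl⟩ | ha
  · exact Or.inr (List.head_mem _)
  · exact Or.inl ha

/-- A new edge at `g` leads to `I₁`. [folklore] -/
theorem eq_head_of_newEdge_g {q : slab 3 k} (h : s(cn.g, q) ∈ cn.newEdges) : q = cn.I.head cn.hI := by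
  obtain ⟨l', hl'⟩ := eq_of_mem_edgesOf_head (l := cn.I ++ [cn.x₁]) cn.hnodup h
  obtain ⟨i, is, hi⟩ := List.exists_cons_of_ne_nil cn.hI
  rw [eq_comm, List.head_eq_iff_head?_eq_some, hi]
  rw [hi] at hl'
  simp only [List.cons_append, List.cons.injEq] at hl'
  simp [hl'.1]

/-- The new edges are lattice edges. [folklore] -/
theorem newEdges_subset_edgeSet : cn.newEdges ⊆ (slabGraph 3 k).edgeSet :=
  edgesOf_subset_edgeSet cn.hchain

/-! ### The new configuration -/

/-- Off the pairs incident to the interior, the new configuration agrees with `ω`. [folklore] -/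
theorem mem_newConfig_iff_of_not_incid {e : Sym2 (slab 3 k)} (he : e ∉ incid k cn.I) :
    e ∈ cn.newConfig ↔ e ∈ ω := by
  constructor
  · rintro (h | h)
    · exact h.1
    · exact absurd (cn.newEdges_incid h) he
  · exact fun h => Or.inl ⟨h, he⟩

/-- `ω' ⊆ ω ∪ newEdges`. [folklore] -/
theorem newConfig_subset : cn.newConfig ⊆ ω ∪ cn.newEdges := by
  rintro e (h | h)
  · exact Or.inl h.1
  · exact Or.inr h

/-- An old edge avoiding the interior stays open. [folklore] -/
theorem mem_newConfig_of_mem {a b : slab 3 k} (h : s(a, b) ∈ ω) (ha : a ∉ cn.I) (hb : b ∉ cn.I) :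
    s(a, b) ∈ cn.newConfig :=
  Or.inl ⟨h, fun h' => by rw [mk_mem_incid_iff] at h'; exact h'.elim ha hb⟩

/-- New edges are open. [folklore] -/
theorem newEdges_subset_newConfig : cn.newEdges ⊆ cn.newConfig := fun _ h => Or.inr h

/-- The new configuration is a lattice configuration. [folklore] -/
theorem newConfig_lattice (hω : ω ⊆ (slabGraph 3 k).edgeSet) : cn.newConfig ⊆ (slabGraph 3 k).edgeSet := by
  rintro e (h | h)
  · exact hω h.1
  · exact cn.newEdges_subset_edgeSet h

/-- The new configuration consists of old edges and lattice edges of the window. [folklore] -/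
theorem newConfig_subset_window (hA : ω ∈ G.evA k) :
    cn.newConfig ⊆ ω ∪ ((slabGraph 3 k).edgeSet ∩ (slabLift k (G.big ∪ G.small)).sym2) := by
  rintro e (h | h)
  · exact Or.inl h.1
  · refine Or.inr ⟨cn.newEdges_subset_edgeSet h, ?_⟩
    induction e using Sym2.ind with
    | h a b =>
      obtain ⟨ha, hb⟩ := cn.newEdges_path h
      exact Set.mk_mem_sym2_iff.2 ⟨cn.path_subset_region hA ha, cn.path_subset_region hA hb⟩

/-- An open edge of `ω'` at an interior vertex is a new edge. [folklore] -/
theorem newEdge_of_mem_I {a b : slab 3 k} (h : s(a, b) ∈ cn.newConfig) (hb : b ∈ cn.I) :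
    s(a, b) ∈ cn.newEdges := by
  rcases h with h | h
  · exact absurd (mk_mem_incid_iff.2 (Or.inr hb)) h.2
  · exact h

/-- `γ_min(ω)` is `ω'`-open (no vertex of it is interior). [folklore] -/
theorem γ_isOSAP (hA : ω ∈ G.evA k) :
    IsOSAP k cn.newConfig (slabLift k G.big) (slabLift k G.src) (slabLift k G.zSeg) (G.γmin k ω) :=
  (G.γmin_spec k hA).1.of_edges fun a ha b hb hab => cn.mem_newConfig_of_mem hab
    (fun h => cn.hIγ a h ha) (fun h => cn.hIγ b h hb)

/-- `σ` is `ω'`-open. [folklore] -/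
theorem σ_chain' : cn.σ.IsChain (fun a b => s(a, b) ∈ cn.newConfig ∧ a ≠ b) :=
  cn.hσchain.imp_of_mem_imp fun a b ha hb h =>
    ⟨cn.mem_newConfig_of_mem h.1 (fun h' => cn.hIσ a h' ha) (fun h' => cn.hIσ b h' hb), h.2⟩

/-- The attached path is `ω'`-open. [folklore] -/
theorem path_chain' : cn.path.IsChain (fun a b => s(a, b) ∈ cn.newConfig ∧ a ≠ b) :=
  isChain_of_edgesOf_subset cn.hchain cn.newEdges_subset_newConfig

end GlueGeom.Connector

end ConnectorData

/-! ## Stability of the minimal path -/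

section Stability

namespace GlueGeom.Connector

variable {k : ℕ} {G : GlueGeom} {ω : BondConfig (slab 3 k)} (cn : G.Connector k ω)

/-- PROVED — **`γ_min(ω') = γ_min(ω)`** for the connector surgery (DST 2016, §2.3, proof of Fact 2:
"the minimality of `γ_min(ω)` … implies"), by the exchange lemma `minPath_eq_of_surgery` with
structure `I ∪ {x₁}`, protected set `I`: the interior is entered only along the attached path,
`x₁` is not `ω`-joined to `S̄_{3n}` (that would give `C(ω)` through `σ`), no interior vertex lies
over `S_{3n}`, and the order condition holds at `g`. [cite: DuminilCopinSidoraviciusTassion2016, §2.3, proof of Fact 2 (p. 7)] -/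
theorem γmin_newConfig (hX : ω ∈ G.evX k) : G.γmin k cn.newConfig = G.γmin k ω := by
  have hA : ω ∈ G.evA k := hX.1.1.1
  have hC : ω ∉ G.evC k := hX.2
  have hS := G.big_finite k
  have hγO := (G.γmin_spec k hA).1
  have hex : ∃ l, IsOSAP k ω (slabLift k G.big) (slabLift k G.src) (slabLift k G.zSeg) l :=
    (mem_slabConn_iff_exists_isOSAP ω _ _ _).1 hA
  have hγeq : minPath k ω (slabLift k G.big) (slabLift k G.src) (slabLift k G.zSeg) = G.γmin k ω := rfl
  have hx₁γ : cn.x₁ ∉ G.γmin k ω := cn.σ_not_mem_γ hA hC cn.x₁_mem_σ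
  have hpathγ : ∀ x ∈ cn.path, x ∈ G.γmin k ω → x = cn.g := by
    intro x hx hxγ
    rcases cn.mem_path_iff.1 hx with h | h | h
    · exact h
    · exact absurd hxγ (cn.hIγ x h)
    · exact absurd hxγ (h ▸ hx₁γ)
  change minPath k cn.newConfig _ _ _ = _
  refine minPath_eq_of_surgery hS hex cn.newEdges {x | x ∈ cn.I} {x | x ∈ cn.I ∨ x = cn.x₁}
    (cn.γ_isOSAP hA) cn.newConfig_subset (fun x hx => Or.inl hx) ?_ ?_ ?_ ?_ ?_
  · -- `h8`: new edges join path vertices, never two `γ`-vertices; at a `γ`-vertex they enter `I`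
    intro a b hab
    rw [hγeq]
    obtain ⟨a', b', l₁, l₂, hl, he⟩ := hab
    have hcons := cn.consec_cases hl
    have hb'mem := cn.consec_snd_mem hl
    have hb'Sw : b' ∈ {x | x ∈ cn.I ∨ x = cn.x₁} := hb'mem
    have hb'γ : b' ∉ G.γmin k ω := by
      rcases hb'mem with h | rfl
      · exact cn.hIγ b' h
      · exact hx₁γ
    have ha'prop : (a' ∈ G.γmin k ω ∨ a' ∈ {x | x ∈ cn.I ∨ x = cn.x₁}) ∧
        (a' ∈ G.γmin k ω → b' ∈ {x | x ∈ cn.I}) := by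
      rcases hcons with ⟨rfl, rfl⟩ | ha'I
      · exact ⟨Or.inl cn.hg, fun _ => List.head_mem _⟩
      · exact ⟨Or.inr (Or.inl ha'I), fun h => absurd h (cn.hIγ a' ha'I)⟩
    rcases Sym2.eq_iff.1 he with ⟨rfl, rfl⟩ | ⟨rfl, rfl⟩
    · exact ⟨ha'prop.1, Or.inr hb'Sw, fun h => hb'γ h.2, ha'prop.2, fun h => absurd h hb'γ⟩
    · exact ⟨Or.inr hb'Sw, ha'prop.1, fun h => hb'γ h.1, fun h => absurd h hb'γ, ha'prop.2⟩
  · -- `h2`: open edges into the interior are new edges, from path vertices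
    intro a b hab hbW
    rw [hγeq]
    have hne := cn.newEdge_of_mem_I hab hbW
    obtain ⟨ha, -⟩ := cn.newEdges_path hne
    rcases cn.mem_path_iff.1 ha with rfl | h | rfl
    · exact Or.inl cn.hg
    · exact Or.inr (Or.inl h)
    · exact Or.inr (Or.inr rfl)
  · -- `h4`: `x₁` is not `ω`-joined inside `B̄_{3n}` to `S̄_{3n}`
    intro q hq hqW _ x hx hj
    have hqx : q = cn.x₁ := by
      rcases hq with h | h
      · exact absurd h hqW
      · exact h
    subst hqx
    exact cn.σ_not_joined hC cn.x₁_mem_σ hx (openConnIn_mono (slabLift_mono k Set.subset_union_left) _ _ hj)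
  · -- `h5`: no interior vertex over `S_{3n}`
    intro v hv hvX
    exact absurd hvX (cn.hIsrc v hv)
  · -- `h6`: the order condition at `g`
    intro p c d r hγ a haSw haγ hca
    rw [hγeq] at hγ haγ
    have hcγ : c ∈ G.γmin k ω := by rw [hγ]; simp
    rcases hca with ⟨hω, hninc⟩ | hnew
    · -- an old edge from `γ` to a structure vertex: it leads to `x₁`, giving `C(ω)`
      exfalso
      have haI : a ∉ cn.I := fun h => hninc (mk_mem_incid_iff.2 (Or.inr h))
      have hax : a = cn.x₁ := by
        rcases haSw with h | h
        · exact absurd h haI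
        · exact h
      subst hax
      have h1 : ω ∈ openConnIn (slabLift k (G.big ∪ G.small)) ((G.γmin k ω).head hγO.ne_nil) c :=
        openConnIn_mono (slabLift_mono k Set.subset_union_left) _ _ (hγO.openConnIn_of_mem hcγ)
      have h2 : ω ∈ openConnIn (slabLift k (G.big ∪ G.small)) c cn.x₁ :=
        openConnIn_head_of_mem c [cn.x₁]
          (List.isChain_cons_cons.2 ⟨⟨hω, fun h => hx₁γ (h ▸ hcγ)⟩, List.isChain_singleton _⟩)
          (fun v hv => by
            simp only [List.mem_cons, List.not_mem_nil, or_false] at hv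
            rcases hv with rfl | rfl
            · exact slabLift_mono k Set.subset_union_left (hγO.subset _ hcγ)
            · exact slabLift_mono k Set.subset_union_right (cn.hσsmall _ cn.x₁_mem_σ))
          cn.x₁ (by simp)
      exact cn.σ_not_joined hC cn.x₁_mem_σ (hγO.head_mem _) (SlabCriticality.openConnIn_trans h1 h2)
    · -- a new edge at `c ∈ γ`: `c = g` and `a = I₁`
      obtain ⟨hc', -⟩ := cn.newEdges_path hnew
      have hcg : c = cn.g := hpathγ c hc' hcγ
      subst hcg
      have ha : a = cn.I.head cn.hI := cn.eq_head_of_newEdge_g hnew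
      rw [ha]
      exact cn.hfwd p r d hγ

end GlueGeom.Connector

end Stability

/-! ## `ω' ∈ C` and the attachment statistic -/

section Attachment

namespace GlueGeom.Connector

variable {k : ℕ} {G : GlueGeom} {ω : BondConfig (slab 3 k)} (cn : G.Connector k ω)

/-- **The attachment vertex is recovered**: `g ∈ Att(ω')`, through `I`, `x₁` and `σ`.
[cite: DuminilCopinSidoraviciusTassion2016, §2.3, proof of Fact 2 (p. 7)] -/
theorem g_mem_att (hX : ω ∈ G.evX k) : cn.g ∈ G.att k cn.newConfig := by
  have hA : ω ∈ G.evA k := hX.1.1.1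
  have hC : ω ∉ G.evC k := hX.2
  rw [GlueGeom.att, Set.mem_setOf_eq, cn.γmin_newConfig hX]
  refine ⟨cn.hg, cn.σ.getLast cn.σ_ne_nil, cn.hσsrc' _, ?_⟩
  have hpath : cn.path = (cn.g :: cn.I) ++ [cn.x₁] := by simp [path]
  have h1 := cn.path_chain'
  rw [hpath, List.isChain_append] at h1
  obtain ⟨h1a, -, h1c⟩ := h1
  have hch : ((cn.g :: cn.I) ++ cn.σ).IsChain (fun a b => s(a, b) ∈ cn.newConfig ∧ a ≠ b) := by
    refine List.IsChain.append h1a cn.σ_chain' fun x hx y hy => h1c x hx y ?_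
    rw [cn.hσ] at hy
    simpa using hy
  have hsub : ∀ x ∈ (cn.g :: cn.I) ++ cn.σ,
      x ∈ slabLift k (G.big ∪ G.small) ∩ {v | v ∉ G.γmin k ω ∨ v = cn.g} := by
    intro x hx
    rcases List.mem_append.1 hx with hx | hx
    · rcases List.mem_cons.1 hx with rfl | hx
      · exact ⟨slabLift_mono k Set.subset_union_left ((G.γmin_spec k hA).1.subset _ cn.hg), Or.inr rfl⟩
      · exact ⟨cn.hIreg x hx, Or.inl (cn.hIγ x hx)⟩
    · exact ⟨slabLift_mono k Set.subset_union_right (cn.hσsmall x hx), Or.inl (cn.σ_not_mem_γ hA hC hx)⟩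
  have hconn := openConnIn_of_isChain cn.g (cn.I ++ cn.σ) hch hsub
  have hlast : (cn.g :: (cn.I ++ cn.σ)).getLast (List.cons_ne_nil _ _) = cn.σ.getLast cn.σ_ne_nil := by
    rw [List.getLast_cons (by simp [cn.σ_ne_nil]), List.getLast_append_of_ne_nil _ cn.σ_ne_nil]
  rw [hlast] at hconn
  exact hconn

/-- **The new configuration realises `C`**: `S_{3n} ⟷ S'_n` in `B̄_{3n} ∪ B̄'_n` (along `γ_min(ω)`
to `g`, the attached path, and `σ`). [cite: DuminilCopinSidoraviciusTassion2016, §2.3, proof of Fact 2 ("By construction, ω^{(z)} is in {S_{3n} ⟷ S'_n}")] -/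
theorem newConfig_mem_evC (hX : ω ∈ G.evX k) : cn.newConfig ∈ G.evC k := by
  have hA : ω ∈ G.evA k := hX.1.1.1
  obtain ⟨-, s'', hs'', hj⟩ := cn.g_mem_att hX
  have h1 := (cn.γ_isOSAP hA).openConnIn_of_mem cn.hg
  exact ⟨_, (G.γmin_spec k hA).1.head_mem _, s'', hs'', SlabCriticality.openConnIn_trans
    (openConnIn_mono (slabLift_mono k Set.subset_union_left) _ _ h1)
    (openConnIn_mono (fun x hx => hx.1) _ _ hj)⟩

/-- **The statistic localises the surgery**: `Att(ω') ⊆ {g}` — another vertex of `γ_min(ω)`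
joined to `S̄'_n` off `γ_min(ω)` in `ω'` would be so in `ω` (the propagation lemma
`not_mem_structure_of_openConnIn`: the interior is entered only from `g`, which is excluded, and
`x₁` is not `ω`-joined to `S̄_{3n}`), giving `C(ω)`. [cite: DuminilCopinSidoraviciusTassion2016, §2.3, proof of Fact 2 (p. 7)] -/
theorem att_subset (hX : ω ∈ G.evX k) : G.att k cn.newConfig ⊆ {cn.g} := by
  have hA : ω ∈ G.evA k := hX.1.1.1
  have hC : ω ∉ G.evC k := hX.2
  have hγO := (G.γmin_spec k hA).1
  rintro q ⟨hqμ, s'', hs'', hj⟩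
  rw [cn.γmin_newConfig hX] at hqμ hj
  rw [Set.mem_singleton_iff]
  by_contra hqg
  apply hC
  refine ⟨_, hγO.head_mem hγO.ne_nil, s'', hs'', ?_⟩
  refine (not_mem_structure_of_openConnIn (Reg := slabLift k (G.big ∪ G.small))
    (A := slabLift k (G.big ∪ G.small) ∩ {v | v ∉ G.γmin k ω ∨ v = q})
    (fun x hx => hx.1) cn.newEdges {x | x = cn.g ∨ x ∈ cn.I} {x | x ∈ cn.path} {cn.g} ?_
    ((G.γmin k ω).head hγO.ne_nil) cn.newConfig_subset (fun a b h => cn.newEdges_path h)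
    ?_ ?_ ?_ hj ?_ ?_).2
  · -- protected vertices are path vertices
    rintro x (rfl | hx)
    · show cn.g ∈ cn.path
      simp [path]
    · show x ∈ cn.path
      simp [path, hx]
  · -- edges into protected vertices: into `I` only new edges; `g` is kept
    intro t x htx hxW
    rcases hxW with rfl | hxI
    · exact Or.inr rfl
    · exact Or.inl (cn.newEdges_path (cn.newEdge_of_mem_I htx hxI)).1
  · -- `g ∉ A`
    rintro x ⟨-, hx⟩ hxK
    rw [Set.mem_singleton_iff] at hxK
    subst hxK
    rcases hx with h | h
    · exact absurd cn.hg h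
    · exact absurd h.symm hqg
  · -- `x₁` is not `ω`-joined to `S̄_{3n}`
    intro x hx hxW hj'
    have hx₁ : x = cn.x₁ := by
      rcases cn.mem_path_iff.1 hx with h | h | h
      · exact absurd (Or.inl h) hxW
      · exact absurd (Or.inr h) hxW
      · exact h
    subst hx₁
    exact cn.σ_not_joined hC cn.x₁_mem_σ (hγO.head_mem _) hj'
  · -- `q` is not a path vertex
    intro hq
    rcases cn.mem_path_iff.1 hq with h | h | h
    · exact hqg h
    · exact cn.hIγ q h hqμ
    · exact cn.σ_not_mem_γ hA hC cn.x₁_mem_σ (h ▸ hqμ)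
  · exact openConnIn_mono (slabLift_mono k Set.subset_union_left) _ _ (hγO.openConnIn_of_mem hqμ)

/-- PROVED — **the connector surgery is a located surgery output**: if the interior lies over
`z + B_r` and `g` over `z + B_3`, then `ω'` is an output `GlueGeom.SurgOut G k r ω z`
(`newConfig_mem_evC`, `newConfig_subset_window`, `mem_newConfig_iff_of_not_incid`, `g_mem_att`,
`att_subset`). [cite: DuminilCopinSidoraviciusTassion2016, §2.3, proof of Fact 2 (pp. 6–7)] -/
theorem surgOut (hX : ω ∈ G.evX k) {z : ℤ × ℤ} {r : ℕ} (hg3 : planar k cn.g ∈ sqBox z 3)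
    (hIr : ∀ x ∈ cn.I, planar k x ∈ sqBox z r) : G.SurgOut k r ω z cn.newConfig where
  mem_evC := cn.newConfig_mem_evC hX
  subset_window := cn.newConfig_subset_window hX.1.1.1
  agree_off := fun e he => cn.mem_newConfig_iff_of_not_incid fun h => he (incid_subset_touch hIr h)
  att_nonempty := ⟨cn.g, cn.g_mem_att hX⟩
  att_near := fun q hq => by
    have := cn.att_subset hX hq
    rw [Set.mem_singleton_iff] at this
    rw [this]; exact hg3

end GlueGeom.Connector

end Attachment

end Literature.Probability.Percolation

end
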